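import Literature.Analysis.OperatorTheory.KernelRatioLimit
import Literature.Analysis.OperatorTheory.KernelOverlapContinuity
import Literature.MathematicalPhysics.KineticTheory.InfiniteChainIntervalPeel
import Literature.MathematicalPhysics.KineticTheory.InfiniteChainTransferBridge
import Literature.MathematicalPhysics.KineticTheory.InfiniteChainGibbsExistence
import Literature.MathematicalPhysics.KineticTheory.InfiniteChainGibbsWindowValue
import HarnessLib

/-!
# Uniqueness of the tight infinite-volume Gibbs state of the anharmonic chain — PROVED

Topic `Literature/MathematicalPhysics/KineticTheory`; theorems only (no definitions, no named
facts). The DLR-uniqueness half of the transfer-operator theory of one-dimensional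
nearest-neighbour models with a strictly positive Hilbert–Schmidt transfer kernel
(Cassandro–Olivieri–Pellegrinotti–Presutti 1978 §2 for unbounded spins; Georgii 2011, Thm 10.25,
§11.1; spectral input Reed–Simon IV, Thms XIII.43–44), for the oscillator chain `P` at `T > 0` with
`U, V` continuous, `V ≥ 0` even, `e^{-U/T} ∈ L¹` (existence: `InfiniteChainGibbsExistence(Shift)`):

* `chainSpecification_Icc_tendsto_uniformly` — `γ_{ {a-N,…,a+n+N} }(A | η) → L ∈ [0, 1]` for a
  window event `A`, UNIFORMLY over the boundary conditions whose boundary positions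
  `q_{a-N-1}, q_{a+n+N+1}` stay bounded (ratios of marginal integrals
  `chainSpecification_apply_eq_lmarginal_div` + two-sided peel `lmarginal_interval_eq_iterate` +
  the `ℝ≥0∞`/real dictionary of `InfiniteChainTransferBridge` + the spectral-gap ratio limit
  `exists_kernelRatio_tendsto_uniformly`, the Perron–Frobenius overlap being bounded below on
  compacts by `exists_pos_forall_le_integral_mul_kernel`);
* `eq_of_isChainGibbsMeasure_of_tight` (**main**) — **two DLR Gibbs states at the same temperature
  whose one-site position marginals are uniformly tight coincide** (with
  `measureReal_eq_of_isChainGibbsMeasure_of_tight` they agree on measurable cylinders);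
* `eq_of_isChainGibbsMeasure_of_tight_pinnedChain` — the pinned anharmonic chain
  (`ω₂ > 0`, `lam, β ≥ 0`) at every `T > 0`.

Tightness cannot be dropped (already the harmonic pinned chain has non-tight DLR states, Gaussian
states centred at exponentially growing equilibrium profiles); Buttà–Marchioro superstable states
are tight. [folklore]
-/


noncomputable section

open MeasureTheory Set Function Finset Filter Literature.Probability.LatticeModels
  Literature.Analysis.OperatorTheory
open scoped ENNReal

namespace Literature.MathematicalPhysics.KineticTheory.HeatConduction

namespace OscillatorChain

variable (P : OscillatorChain)

omit P in
/-- The bonds meeting the nonempty interval `{c+1, …, d}` (`c < d`) are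
`bondSet {c+1,…,d} = {c, …, d}`. [folklore] -/
theorem bondSet_Icc_add_one (c d : ℤ) (hcd : c < d) : bondSet (Finset.Icc (c + 1) d) = Finset.Icc c d := by
  ext y
  rw [mem_bondSet_iff]
  simp only [Finset.mem_Icc]
  omega

/-- **Finite-volume Gibbs probabilities of window events forget far-away boundary conditions,
uniformly on bounded boundary positions.** Let `T > 0`, `U`, `V` continuous, `V ≥ 0` even,
`e^{-U/T} ∈ L¹`, and `A` a measurable event read on the window `{a, …, a+n}`. Then there is
`L ∈ [0, 1]` with: for every `R` and `ε > 0` there is `N₀` such that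
`|γ_{ {a-N,…,a+n+N} }(A | η) - L| < ε` for all `N ≥ N₀` and all `η` with
`|q_{a-N-1}|, |q_{a+n+N+1}| ≤ R` (transfer-operator proof, Jentzsch spectral gap). [folklore] -/
theorem chainSpecification_Icc_tendsto_uniformly {T : ℝ} (hT : 0 < T)
    (hUc : Continuous P.U) (hVc : Continuous P.V) (hV0 : ∀ r, 0 ≤ P.V r)
    (hVe : ∀ r, P.V (-r) = P.V r) (hUi : Integrable (fun q : ℝ => Real.exp (-T⁻¹ * P.U q)))
    (a : ℤ) (n : ℕ) {A : Set ChainConfig} (hA : MeasurableSet A)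
    (hAd : DependsOn (A.indicator (1 : ChainConfig → ℝ≥0∞)) (↑(Finset.Icc a (a + n)) : Set ℤ)) :
    ∃ L : ℝ, 0 ≤ L ∧ L ≤ 1 ∧ ∀ R ε : ℝ, 0 < ε → ∃ N₀ : ℕ, ∀ N : ℕ, N₀ ≤ N →
      ∀ η : ChainConfig, |(η (a - N - 1)).1| ≤ R → |(η (a + n + N + 1)).1| ≤ R →
        |((P.chainSpecification T (Finset.Icc (a - N) (a + n + N)) η) A).toReal - L| < ε := by
  classical
  have hUm : Measurable P.U := hUc.measurable
  have hVm : Measurable P.V := hVc.measurable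
  -- the transfer data: one-site weight `w`, a priori measure `ρ = w · Leb`, bond kernel `K`
  set wt : ℝ × ℝ → ℝ := fun z => Real.exp (-T⁻¹ * (z.2 ^ 2 / 2 + P.U z.1)) with hwt
  set w : ℝ × ℝ → ℝ≥0∞ := fun z => ENNReal.ofReal (wt z) with hw
  set K : ℝ × ℝ → ℝ × ℝ → ℝ := fun z z' => Real.exp (-T⁻¹ * P.V (z'.1 - z.1)) with hK
  have hwtc : Continuous wt := by simp only [hwt]; fun_prop
  have hwti : Integrable wt := P.integrable_siteWeight hT hUi
  have hwtpos : ∀ z, 0 < wt z := fun z => Real.exp_pos _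
  have hwm : Measurable w := ENNReal.measurable_ofReal.comp hwtc.measurable
  have hw0 : ∀ z, 0 < w z := fun z => ENNReal.ofReal_pos.2 (hwtpos z)
  haveI hfin : IsFiniteMeasure (volume.withDensity w) := isFiniteMeasure_withDensity_ofReal hwti.2
  have hρ0 : volume.withDensity w ≠ 0 := by
    intro h0
    have h1 : volume.withDensity w univ = 0 := by rw [h0]; rfl
    rw [withDensity_apply _ MeasurableSet.univ, Measure.restrict_univ, lintegral_eq_zero_iff hwm] at h1
    have h3 : {z : ℝ × ℝ | w z ≠ (0 : ℝ × ℝ → ℝ≥0∞) z} = univ :=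
      eq_univ_of_forall fun z => (hw0 z).ne'
    have h2 : (volume : Measure (ℝ × ℝ)) {z | w z ≠ (0 : ℝ × ℝ → ℝ≥0∞) z} = 0 := h1
    rw [h3] at h2
    exact (isOpen_univ.measure_pos (volume : Measure (ℝ × ℝ)) univ_nonempty).ne' h2
  have hZw : (∫⁻ z, w z) ≠ ∞ := by
    have h := measure_ne_top (volume.withDensity w) univ
    rwa [withDensity_apply _ MeasurableSet.univ, Measure.restrict_univ] at h
  have hKc : Continuous (uncurry K) := by
    show Continuous fun p : (ℝ × ℝ) × (ℝ × ℝ) => Real.exp (-T⁻¹ * P.V (p.2.1 - p.1.1))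
    fun_prop
  have hKsm : StronglyMeasurable (uncurry K) := hKc.stronglyMeasurable
  have hKpos : ∀ z z', 0 < K z z' := fun z z' => Real.exp_pos _
  have hK0 : ∀ z z', 0 ≤ K z z' := fun z z' => (hKpos z z').le
  have hK1 : ∀ z z', ‖K z z'‖ ≤ 1 := fun z z' => by
    rw [Real.norm_eq_abs, abs_of_pos (hKpos z z')]
    show Real.exp (-T⁻¹ * P.V (z'.1 - z.1)) ≤ 1
    rw [Real.exp_le_one_iff]
    have := hV0 (z'.1 - z.1)
    have := inv_pos.2 hT
    nlinarith
  have hKsymm : ∀ z z', K z z' = K z' z := fun z z' => by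
    show Real.exp (-T⁻¹ * P.V (z'.1 - z.1)) = Real.exp (-T⁻¹ * P.V (z.1 - z'.1))
    rw [← hVe (z.1 - z'.1), neg_sub]
  have hkm : Measurable (uncurry fun z z' => ENNReal.ofReal (K z z')) :=
    ENNReal.measurable_ofReal.comp hKc.measurable
  have hk1 : ∀ z z', ENNReal.ofReal (K z z') ≤ 1 := fun z z' =>
    ENNReal.ofReal_le_one.2 ((le_abs_self _).trans ((Real.norm_eq_abs _).symm.le.trans (hK1 z z')))
  have hk0 : ∀ z z', 0 < ENNReal.ofReal (K z z') := fun z z' => ENNReal.ofReal_pos.2 (hKpos z z')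
  -- the factorisation of the Boltzmann weight
  have hfac : ∀ (Λ : Finset ℤ) (σ : ChainConfig),
      ENNReal.ofReal (Real.exp (-T⁻¹ * hamiltonianIn P.chainPotential chainSupp Λ σ)) =
        (∏ x ∈ Λ, w (σ x)) * ∏ y ∈ bondSet Λ, ENNReal.ofReal (K (σ y) (σ (y + 1))) := fun Λ σ => by
    rw [P.ofReal_exp_neg_hamiltonianIn T Λ σ]
  -- the window kernels
  set η₀ : ChainConfig := fun _ => ((0 : ℝ), (0 : ℝ)) with hη₀
  obtain ⟨Φ₁, hΦ₁⟩ : ∃ Φ₁ : ChainConfig → ℝ≥0∞, ∀ σ, Φ₁ σ = 1 := ⟨fun _ => 1, fun _ => rfl⟩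
  have hΦ₁m : Measurable Φ₁ := by
    rw [show Φ₁ = fun _ => 1 from funext hΦ₁]; exact measurable_const
  have hΦ₁d : DependsOn Φ₁ (↑(Finset.Icc a (a + n)) : Set ℤ) := fun x y _ => by rw [hΦ₁, hΦ₁]
  have hAm : Measurable (A.indicator (1 : ChainConfig → ℝ≥0∞)) := measurable_one.indicator hA
  have hA1 : ∀ σ, A.indicator (1 : ChainConfig → ℝ≥0∞) σ ≤ 1 := fun σ => by
    by_cases h : σ ∈ A
    · rw [indicator_of_mem h, Pi.one_apply]
    · rw [indicator_of_notMem h]; exact zero_le_one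
  set m : ℝ × ℝ → ℝ × ℝ → ℝ := fun x y => ((∫⋯∫⁻_Finset.Icc a (a + n - 1), (fun σ =>
    A.indicator (1 : ChainConfig → ℝ≥0∞) σ *
      ((∏ i ∈ Finset.range n, ENNReal.ofReal (K (σ (a - 1 + i)) (σ (a - 1 + i + 1))) *
        w (σ (a - 1 + i + 1))) * ENNReal.ofReal (K (σ (a + n - 1)) (σ (a + n)))))
      ∂fun _ : ℤ => (volume : Measure (ℝ × ℝ)))
    (Function.update (Function.update η₀ (a - 1) x) (a + n) y)).toReal with hm
  set m₁ : ℝ × ℝ → ℝ × ℝ → ℝ := fun x y => ((∫⋯∫⁻_Finset.Icc a (a + n - 1), (fun σ => Φ₁ σ *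
      ((∏ i ∈ Finset.range n, ENNReal.ofReal (K (σ (a - 1 + i)) (σ (a - 1 + i + 1))) *
        w (σ (a - 1 + i + 1))) * ENNReal.ofReal (K (σ (a + n - 1)) (σ (a + n)))))
      ∂fun _ : ℤ => (volume : Measure (ℝ × ℝ)))
    (Function.update (Function.update η₀ (a - 1) x) (a + n) y)).toReal with hm₁
  -- generic facts about the window kernel of an observable `Φ ≤ 1`
  have hWK : ∀ (Φ : ChainConfig → ℝ≥0∞), Measurable Φ → (∀ σ, Φ σ ≤ 1) →
      (∀ x y, (∫⋯∫⁻_Finset.Icc a (a + n - 1), (fun σ => Φ σ *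
        ((∏ i ∈ Finset.range n, ENNReal.ofReal (K (σ (a - 1 + i)) (σ (a - 1 + i + 1))) *
          w (σ (a - 1 + i + 1))) * ENNReal.ofReal (K (σ (a + n - 1)) (σ (a + n)))))
        ∂fun _ : ℤ => (volume : Measure (ℝ × ℝ)))
        (Function.update (Function.update η₀ (a - 1) x) (a + n) y) ≠ ∞) ∧
      StronglyMeasurable (uncurry fun x y => ((∫⋯∫⁻_Finset.Icc a (a + n - 1), (fun σ => Φ σ *
        ((∏ i ∈ Finset.range n, ENNReal.ofReal (K (σ (a - 1 + i)) (σ (a - 1 + i + 1))) *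
          w (σ (a - 1 + i + 1))) * ENNReal.ofReal (K (σ (a + n - 1)) (σ (a + n)))))
        ∂fun _ : ℤ => (volume : Measure (ℝ × ℝ)))
        (Function.update (Function.update η₀ (a - 1) x) (a + n) y)).toReal) ∧
      ∀ x y, ‖((∫⋯∫⁻_Finset.Icc a (a + n - 1), (fun σ => Φ σ *
        ((∏ i ∈ Finset.range n, ENNReal.ofReal (K (σ (a - 1 + i)) (σ (a - 1 + i + 1))) *
          w (σ (a - 1 + i + 1))) * ENNReal.ofReal (K (σ (a + n - 1)) (σ (a + n)))))
        ∂fun _ : ℤ => (volume : Measure (ℝ × ℝ)))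
        (Function.update (Function.update η₀ (a - 1) x) (a + n) y)).toReal‖ ≤
        ((∫⁻ z, w z) ^ n).toReal := by
    intro Φ hΦm hΦ1
    have hle := fun x y => windowKernel_le (k := fun z z' => ENNReal.ofReal (K z z')) hwm hk1 hΦ1 a n
      (Function.update (Function.update η₀ (a - 1) x) (a + n) y)
    have htop : (∫⁻ z, w z) ^ n ≠ ∞ := ENNReal.pow_ne_top hZw
    refine ⟨fun x y => ne_top_of_le_ne_top htop (hle x y), ?_, fun x y => ?_⟩
    · exact (ENNReal.measurable_toReal.comp
        (measurable_windowKernel (k := fun z z' => ENNReal.ofReal (K z z')) hwm hkm hΦm a n η₀)).stronglyMeasurable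
    · rw [Real.norm_eq_abs, abs_of_nonneg ENNReal.toReal_nonneg]
      exact ENNReal.toReal_mono htop (hle x y)
  obtain ⟨hmfin, hmsm, hmb⟩ := hWK _ hAm hA1
  obtain ⟨hm₁fin, hm₁sm, hm₁b⟩ := hWK Φ₁ hΦ₁m (fun σ => (hΦ₁ σ).le)
  have hm₁pos : ∀ x y, 0 < m₁ x y := fun x y =>
    ENNReal.toReal_pos (windowKernel_pos (k := fun z z' => ENNReal.ofReal (K z z')) hwm hkm hw0 hk0
      hΦ₁m (fun σ => by rw [hΦ₁]; exact one_ne_zero) a n _).ne' (hm₁fin x y)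
  -- the spectral input
  obtain ⟨φ₀, L, hφi, hφ0, hφne, hlim⟩ := exists_kernelRatio_tendsto_uniformly
    (μ := volume.withDensity w) hKsm hK1 hKsymm hKpos hρ0 hmsm hmb hm₁sm hm₁b hm₁pos
  -- the overlap is bounded below on bounded boundary positions
  have hover : ∀ R : ℝ, ∃ δ : ℝ, 0 < δ ∧ ∀ u : ℝ × ℝ, |u.1| ≤ R →
      δ ≤ ∫ y, φ₀ y * K u y ∂volume.withDensity w := by
    intro R
    have hcpt : IsCompact ((Set.Icc (-R) R) ×ˢ ({0} : Set ℝ)) := isCompact_Icc.prod isCompact_singleton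
    have hKcu : ∀ y : ℝ × ℝ, Continuous fun u : ℝ × ℝ => K u y := fun y => by
      show Continuous fun u : ℝ × ℝ => Real.exp (-T⁻¹ * P.V (y.1 - u.1))
      fun_prop
    obtain ⟨δ, hδ, hδle⟩ := exists_pos_forall_le_integral_mul_kernel (ρ := volume.withDensity w)
      hKcu hKpos (fun u => (hKsm.measurable.of_uncurry_left).aestronglyMeasurable) hK1 hφi hφ0 hφne
      hcpt
    refine ⟨δ, hδ, fun u hu => ?_⟩
    have hmem : ((u.1, (0 : ℝ)) : ℝ × ℝ) ∈ (Set.Icc (-R) R) ×ˢ ({0} : Set ℝ) :=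
      ⟨⟨by linarith [(abs_le.1 hu).1], (abs_le.1 hu).2⟩, rfl⟩
    exact hδle (u.1, 0) hmem
  -- the kernel as a real ratio: the conversion of one marginal integral
  have hconv : ∀ (Φ : ChainConfig → ℝ≥0∞), Measurable Φ →
      DependsOn Φ (↑(Finset.Icc a (a + n)) : Set ℤ) → (∀ σ, Φ σ ≤ 1) → ∀ (N : ℕ) (η : ChainConfig),
      (∫⋯∫⁻_Finset.Icc (a - N) (a + n + N), (fun σ => Φ σ * ENNReal.ofReal (Real.exp (-T⁻¹ *
          hamiltonianIn P.chainPotential chainSupp (Finset.Icc (a - N) (a + n + N)) σ)))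
        ∂fun _ : ℤ => (volume : Measure (ℝ × ℝ))) η =
        ENNReal.ofReal (((fun g : ℝ × ℝ → ℝ => fun x => ∫ y, K x y * g y ∂volume.withDensity w)^[N]
          (fun x => ∫ y, ((∫⋯∫⁻_Finset.Icc a (a + n - 1), (fun σ => Φ σ *
            ((∏ i ∈ Finset.range n, ENNReal.ofReal (K (σ (a - 1 + i)) (σ (a - 1 + i + 1))) *
              w (σ (a - 1 + i + 1))) * ENNReal.ofReal (K (σ (a + n - 1)) (σ (a + n)))))
            ∂fun _ : ℤ => (volume : Measure (ℝ × ℝ)))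
            (Function.update (Function.update η₀ (a - 1) x) (a + n) y)).toReal *
            ((fun g : ℝ × ℝ → ℝ => fun x => ∫ y, K x y * g y ∂volume.withDensity w)^[N]
              (K (η (a + n + N + 1)))) y ∂volume.withDensity w)) (η (a - N - 1))) ∧
      0 ≤ ((fun g : ℝ × ℝ → ℝ => fun x => ∫ y, K x y * g y ∂volume.withDensity w)^[N]
          (fun x => ∫ y, ((∫⋯∫⁻_Finset.Icc a (a + n - 1), (fun σ => Φ σ *
            ((∏ i ∈ Finset.range n, ENNReal.ofReal (K (σ (a - 1 + i)) (σ (a - 1 + i + 1))) *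
              w (σ (a - 1 + i + 1))) * ENNReal.ofReal (K (σ (a + n - 1)) (σ (a + n)))))
            ∂fun _ : ℤ => (volume : Measure (ℝ × ℝ)))
            (Function.update (Function.update η₀ (a - 1) x) (a + n) y)).toReal *
            ((fun g : ℝ × ℝ → ℝ => fun x => ∫ y, K x y * g y ∂volume.withDensity w)^[N]
              (K (η (a + n + N + 1)))) y ∂volume.withDensity w)) (η (a - N - 1)) := by
    intro Φ hΦm hΦd hΦ1 N η
    obtain ⟨hMfin, hMsm, hMb⟩ := hWK Φ hΦm hΦ1
    set v : ℝ × ℝ := η (a + n + N + 1) with hv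
    -- the real iterate `G = κ^N K(v, ·)`
    obtain ⟨hGeq, hGm, hG0, BG, hGb⟩ := transferStep_iterate_ofReal (ν := (volume : Measure (ℝ × ℝ)))
      hwm hKsm hK1 hK0 (f := K v) hKsm.measurable.of_uncurry_left (fun y => hK0 v y) ⟨1, hK1 v⟩ N
    -- `F x = ∫ M(x, y) G(y) dρ`
    obtain ⟨hFb, hFsm⟩ := exists_bound_and_stronglyMeasurable_integral_kernel_mul
      (μ := volume.withDensity w) hMsm hMb hGm.stronglyMeasurable hGb
    have hF0 : ∀ x, 0 ≤ ∫ y, ((∫⋯∫⁻_Finset.Icc a (a + n - 1), (fun σ => Φ σ *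
        ((∏ i ∈ Finset.range n, ENNReal.ofReal (K (σ (a - 1 + i)) (σ (a - 1 + i + 1))) *
          w (σ (a - 1 + i + 1))) * ENNReal.ofReal (K (σ (a + n - 1)) (σ (a + n)))))
        ∂fun _ : ℤ => (volume : Measure (ℝ × ℝ)))
        (Function.update (Function.update η₀ (a - 1) x) (a + n) y)).toReal *
        ((fun g : ℝ × ℝ → ℝ => fun x => ∫ y, K x y * g y ∂volume.withDensity w)^[N]
          (K v)) y ∂volume.withDensity w := fun x =>
      integral_nonneg fun y => mul_nonneg ENNReal.toReal_nonneg (hG0 y)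
    obtain ⟨hFeq, -, hF0', -⟩ := transferStep_iterate_ofReal (ν := (volume : Measure (ℝ × ℝ)))
      hwm hKsm hK1 hK0 hFsm.measurable hF0 ⟨_, hFb⟩ N
    refine ⟨?_, hF0' _⟩
    -- the peel
    have hpeel := lmarginal_interval_eq_iterate (ν := (volume : Measure (ℝ × ℝ)))
      (k := fun z z' => ENNReal.ofReal (K z z')) (w := w) hkm hwm hΦm (a := a) (b := a + n)
      (ℓ := a - N - 1) (r := a + n + N + 1) (n := n) (N := N) rfl (by ring) rfl hΦd η₀ η
    have hΛ : Finset.Icc (a - (N : ℤ)) (a + n + N) = Finset.Icc (a - N - 1 + 1) (a + n + N + 1 - 1) := by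
      congr 1 <;> ring
    have hbond : bondSet (Finset.Icc (a - (N : ℤ) - 1 + 1) (a + n + N + 1 - 1)) =
        Finset.Icc (a - N - 1) (a + n + N + 1 - 1) := bondSet_Icc_add_one _ _ (by omega)
    have hsymm_fun : (fun z : ℝ × ℝ => ENNReal.ofReal (K z v)) = fun z => ENNReal.ofReal (K v z) :=
      funext fun z => by rw [hKsymm]
    have hinner : (fun x : ℝ × ℝ => ∫⁻ y, (∫⋯∫⁻_Finset.Icc a (a + n - 1), (fun σ => Φ σ *
        ((∏ i ∈ Finset.range n, ENNReal.ofReal (K (σ (a - 1 + i)) (σ (a - 1 + i + 1))) *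
          w (σ (a - 1 + i + 1))) * ENNReal.ofReal (K (σ (a + n - 1)) (σ (a + n)))))
        ∂fun _ : ℤ => (volume : Measure (ℝ × ℝ)))
        (Function.update (Function.update η₀ (a - 1) x) (a + n) y) * w y *
        (((fun G : ℝ × ℝ → ℝ≥0∞ => fun x => ∫⁻ y, ENNReal.ofReal (K x y) * w y * G y)^[N]
          fun z => ENNReal.ofReal (K z v)) y)) =
        fun x => ENNReal.ofReal (∫ y, ((∫⋯∫⁻_Finset.Icc a (a + n - 1), (fun σ => Φ σ *
            ((∏ i ∈ Finset.range n, ENNReal.ofReal (K (σ (a - 1 + i)) (σ (a - 1 + i + 1))) *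
              w (σ (a - 1 + i + 1))) * ENNReal.ofReal (K (σ (a + n - 1)) (σ (a + n)))))
            ∂fun _ : ℤ => (volume : Measure (ℝ × ℝ)))
            (Function.update (Function.update η₀ (a - 1) x) (a + n) y)).toReal *
            ((fun g : ℝ × ℝ → ℝ => fun x => ∫ y, K x y * g y ∂volume.withDensity w)^[N]
              (K v)) y ∂volume.withDensity w) := by
      funext x
      rw [hsymm_fun, hGeq]
      dsimp only
      have hg : Measurable fun y : ℝ × ℝ => ((∫⋯∫⁻_Finset.Icc a (a + n - 1), (fun σ => Φ σ *
          ((∏ i ∈ Finset.range n, ENNReal.ofReal (K (σ (a - 1 + i)) (σ (a - 1 + i + 1))) *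
            w (σ (a - 1 + i + 1))) * ENNReal.ofReal (K (σ (a + n - 1)) (σ (a + n)))))
          ∂fun _ : ℤ => (volume : Measure (ℝ × ℝ)))
          (Function.update (Function.update η₀ (a - 1) x) (a + n) y)).toReal *
          ((fun g : ℝ × ℝ → ℝ => fun x => ∫ y, K x y * g y ∂volume.withDensity w)^[N] (K v)) y :=
        (hMsm.measurable.of_uncurry_left).mul hGm
      rw [← lintegral_weight_mul_ofReal hwm hg
        (fun y => mul_nonneg ENNReal.toReal_nonneg (hG0 y))
        (fun y => mul_le_mul ((le_abs_self _).trans ((Real.norm_eq_abs _).symm.le.trans (hMb x y)))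
          ((le_abs_self _).trans ((Real.norm_eq_abs _).symm.le.trans (hGb y)))
          (hG0 y) ENNReal.toReal_nonneg)]
      refine lintegral_congr fun y => ?_
      rw [ENNReal.ofReal_mul ENNReal.toReal_nonneg, ENNReal.ofReal_toReal (hMfin x y)]
      ring
    rw [hΛ]
    simp only [hfac, hbond]
    rw [hpeel, hinner, hFeq]
  -- the normaliser as `Φ₁`-integral
  have hone : ∀ Λ : Finset ℤ, (fun σ : ChainConfig => ENNReal.ofReal (Real.exp (-T⁻¹ *
      hamiltonianIn P.chainPotential chainSupp Λ σ))) = fun σ => Φ₁ σ * ENNReal.ofReal (Real.exp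
        (-T⁻¹ * hamiltonianIn P.chainPotential chainSupp Λ σ)) := fun Λ =>
    funext fun σ => by rw [hΦ₁, one_mul]
  -- the main estimate
  have hmain : ∀ R ε : ℝ, 0 < ε → ∃ N₀ : ℕ, ∀ N : ℕ, N₀ ≤ N →
      ∀ η : ChainConfig, |(η (a - N - 1)).1| ≤ R → |(η (a + n + N + 1)).1| ≤ R →
        |((P.chainSpecification T (Finset.Icc (a - N) (a + n + N)) η) A).toReal - L| < ε := by
    intro R ε hε
    obtain ⟨δ, hδ, hδle⟩ := hover R
    obtain ⟨N₀, hN₀⟩ := hlim δ hδ ε hε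
    refine ⟨N₀, fun N hN η hηℓ hηr => ?_⟩
    obtain ⟨hNum, hnum0⟩ := hconv _ hAm hAd hA1 N η
    obtain ⟨hDen, -⟩ := hconv Φ₁ hΦ₁m hΦ₁d (fun σ => (hΦ₁ σ).le) N η
    have hDpos := P.lmarginal_boltzmann_pos hUm hVm T (Finset.Icc (a - N) (a + n + N)) η
    rw [hone, hDen] at hDpos
    have hdenpos := ENNReal.ofReal_pos.1 hDpos
    rw [P.chainSpecification_apply_eq_lmarginal_div hUm hVm T _ η hA, hNum, hone, hDen,
      ← ENNReal.ofReal_div_of_pos hdenpos, ENNReal.toReal_ofReal (div_nonneg hnum0 hdenpos.le)]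
    exact hN₀ N hN _ _ (hδle _ hηℓ) (hδle _ hηr)
  -- `L ∈ [0, 1]`
  have hprob : ∀ (Λ : Finset ℤ) (η : ChainConfig), IsProbabilityMeasure (P.chainSpecification T Λ η) :=
    P.condB2_of_integrable_exp_neg hT hUc hVc hV0 (by
      rw [show (fun q : ℝ => Real.exp (-P.U q / T)) = fun q => Real.exp (-T⁻¹ * P.U q) from
        funext fun q => by rw [show -P.U q / T = -T⁻¹ * P.U q by ring]]; exact hUi)
  have hval : ∀ (N : ℕ), 0 ≤ ((P.chainSpecification T (Finset.Icc (a - N) (a + n + N)) η₀) A).toReal ∧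
      ((P.chainSpecification T (Finset.Icc (a - N) (a + n + N)) η₀) A).toReal ≤ 1 := fun N => by
    haveI := hprob (Finset.Icc (a - N) (a + n + N)) η₀
    refine ⟨ENNReal.toReal_nonneg, ENNReal.toReal_le_of_le_ofReal zero_le_one ?_⟩
    rw [ENNReal.ofReal_one]
    exact prob_le_one
  have hη₀0 : ∀ x : ℤ, |(η₀ x).1| ≤ (0 : ℝ) := fun x => by simp [hη₀]
  have hclose : ∀ ε : ℝ, 0 < ε → ∃ N₀ : ℕ,
      |((P.chainSpecification T (Finset.Icc (a - N₀) (a + n + N₀)) η₀) A).toReal - L| < ε :=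
    fun ε hε => by
      obtain ⟨N₀, hN₀⟩ := hmain 0 ε hε
      exact ⟨N₀, hN₀ N₀ le_rfl η₀ (hη₀0 (a - N₀ - 1)) (hη₀0 (a + n + N₀ + 1))⟩
  refine ⟨L, ?_, ?_, hmain⟩ <;> refine le_of_forall_pos_lt_add fun ε hε => ?_ <;>
    obtain ⟨N₀, h⟩ := hclose ε hε <;> have h1 := hval N₀ <;> rw [abs_lt] at h <;> linarith

/-- **Uniqueness of the one-site-tight DLR Gibbs state of the chain.** Let `T > 0`, `U`, `V`
continuous, `V ≥ 0` even, `e^{-U/T} ∈ L¹`. If `μ₁`, `μ₂` are DLR Gibbs states of `P` at `T`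
(`IsChainGibbsMeasure`) whose one-site position marginals are uniformly tight
(`∀ ε > 0 ∃ R ∀ x, μ {R < |q_x|} ≤ ε`), then `μ₁ = μ₂`: both give every cylinder event the same
boundary-condition-free value, and measurable cylinders generate (transfer-operator proof of the
uniqueness of the tempered Gibbs state of one-dimensional unbounded-spin chains,
Cassandro–Olivieri–Pellegrinotti–Presutti 1978 §2; Georgii 2011 Thm 10.25, §11.1). [folklore] -/
theorem eq_of_isChainGibbsMeasure_of_tight {T : ℝ} (hT : 0 < T)
    (hUc : Continuous P.U) (hVc : Continuous P.V) (hV0 : ∀ r, 0 ≤ P.V r)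
    (hVe : ∀ r, P.V (-r) = P.V r) (hUi : Integrable (fun q : ℝ => Real.exp (-T⁻¹ * P.U q)))
    {μ₁ μ₂ : Measure ChainConfig} (h₁ : P.IsChainGibbsMeasure T μ₁) (h₂ : P.IsChainGibbsMeasure T μ₂)
    (ht₁ : ∀ ε : ℝ, 0 < ε → ∃ R : ℝ, ∀ x : ℤ,
      μ₁ {σ : ChainConfig | R < |(σ x).1|} ≤ ENNReal.ofReal ε)
    (ht₂ : ∀ ε : ℝ, 0 < ε → ∃ R : ℝ, ∀ x : ℤ,
      μ₂ {σ : ChainConfig | R < |(σ x).1|} ≤ ENNReal.ofReal ε) :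
    μ₁ = μ₂ := by
  haveI := h₁.1
  haveI := h₂.1
  -- agreement on measurable cylinders, hence everywhere
  have hcyl : ∀ s ∈ measurableCylinders (fun _ : ℤ => ℝ × ℝ), μ₁ s = μ₂ s := by
    intro s hs
    obtain ⟨I, C, hC, rfl⟩ := (mem_measurableCylinders _).1 hs
    -- a window `{a, …, a+n}` containing `I`
    set M : ℕ := I.sup Int.natAbs with hM
    have hI : ∀ x ∈ I, -(M : ℤ) ≤ x ∧ x ≤ -(M : ℤ) + ↑(2 * M) := fun x hx => by
      have := Finset.le_sup (f := Int.natAbs) hx; push_cast; omega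
    have hA : MeasurableSet (cylinder I C) := MeasurableSet.cylinder (α := fun _ : ℤ => ℝ × ℝ) I hC
    have hAd : DependsOn ((cylinder I C).indicator (1 : ChainConfig → ℝ≥0∞))
        (↑(Finset.Icc (-(M : ℤ)) (-(M : ℤ) + ↑(2 * M))) : Set ℤ) := fun x y hxy =>
      dependsOn_cylinder_indicator_const C (1 : ℝ≥0∞) fun i hi => hxy i (by
        simp only [Finset.coe_Icc, Set.mem_Icc]; exact hI i (Finset.mem_coe.1 hi))
    obtain ⟨L, hL0, hL1, hlim⟩ :=
      P.chainSpecification_Icc_tendsto_uniformly hT hUc hVc hV0 hVe hUi (-(M : ℤ)) (2 * M) hA hAd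
    have e₁ := P.measureReal_eq_of_isChainGibbsMeasure_of_tight hT hUc hVc hV0 hUi h₁ ht₁ _ _ hA
      hL0 hL1 hlim
    have e₂ := P.measureReal_eq_of_isChainGibbsMeasure_of_tight hT hUc hVc hV0 hUi h₂ ht₂ _ _ hA
      hL0 hL1 hlim
    rw [measureReal_def] at e₁ e₂
    exact (ENNReal.toReal_eq_toReal_iff' (measure_ne_top μ₁ _) (measure_ne_top μ₂ _)).1
      (e₁.trans e₂.symm)
  have huniv : μ₁ univ = μ₂ univ := by rw [measure_univ, measure_univ]
  exact ext_of_generate_finite (measurableCylinders fun _ : ℤ => ℝ × ℝ)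
    generateFrom_measurableCylinders.symm isPiSystem_measurableCylinders hcyl huniv

/-- **Uniqueness of the tight DLR state of the pinned anharmonic chain.** For
`pinnedChain ω₂ lam β γ` (`U = ω₂q²/2 + lam q⁴/4`, `V = r²/2 + βr⁴/4`, `ω₂ > 0`, `lam, β ≥ 0`) and
`T > 0`, two DLR Gibbs states with uniformly tight one-site position marginals coincide.
[folklore] -/
theorem eq_of_isChainGibbsMeasure_of_tight_pinnedChain {ω₂ lam β : ℝ} (γ : ℝ)
    (hω : 0 < ω₂) (hl : 0 ≤ lam) (hβ : 0 ≤ β) {T : ℝ} (hT : 0 < T)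
    {μ₁ μ₂ : Measure ChainConfig} (h₁ : (pinnedChain ω₂ lam β γ).IsChainGibbsMeasure T μ₁)
    (h₂ : (pinnedChain ω₂ lam β γ).IsChainGibbsMeasure T μ₂)
    (ht₁ : ∀ ε : ℝ, 0 < ε → ∃ R : ℝ, ∀ x : ℤ,
      μ₁ {σ : ChainConfig | R < |(σ x).1|} ≤ ENNReal.ofReal ε)
    (ht₂ : ∀ ε : ℝ, 0 < ε → ∃ R : ℝ, ∀ x : ℤ,
      μ₂ {σ : ChainConfig | R < |(σ x).1|} ≤ ENNReal.ofReal ε) :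
    μ₁ = μ₂ := by
  refine (pinnedChain ω₂ lam β γ).eq_of_isChainGibbsMeasure_of_tight hT ?_ ?_ ?_ ?_
    (integrable_exp_neg_pinning hT hω hl β γ) h₁ h₂ ht₁ ht₂
  · show Continuous fun q : ℝ => ω₂ * q ^ 2 / 2 + lam * q ^ 4 / 4
    fun_prop
  · show Continuous fun r : ℝ => r ^ 2 / 2 + β * r ^ 4 / 4
    fun_prop
  · intro r
    show 0 ≤ r ^ 2 / 2 + β * r ^ 4 / 4
    positivity
  · intro r
    show (-r) ^ 2 / 2 + β * (-r) ^ 4 / 4 = r ^ 2 / 2 + β * r ^ 4 / 4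
    ring

end OscillatorChain

end Literature.MathematicalPhysics.KineticTheory.HeatConduction

end
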